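import Summits.Parity.GeneralizedHardyLittlewood.Theorems.LeeYangFibresModelHyperbolicityCalculus
import HarnessLib

/-!
# Route `LeeYangFibres`, support item `ModelCellFacts` (stmt-Parity-14111):
# the parity point `z = -1` of the Buchstab–Dickman model family (Alladi's parity balance, limit form)

Helper file for the proof of `Summit.Parity.GeneralizedHardyLittlewood.Theses.LeeYangFibres.ModelCellFacts`.
With `cellDensity i u = I_{i+1}(u)` and `modelEval M τ z = Σ_{i<M} I_{i+1}(τ) z^i`
(`LeeYangFibresModelHyperbolicityDefs.lean`), the function `G(τ) := modelEval M τ (-1) = -Σ_{1≤j≤M} (-1)^j I_j(τ)`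
(`modelEval_neg_one`) is `≡ 1` on `[1,2]` and satisfies the delay equation `G'(τ) = -G(τ-1)/(τ-1)` on
`(2, M+1]` (`calc_hasDerivAt_modelEval`). Since `q(τ) = τ - 1` solves the ADJOINT equation
`τ·q'(τ) = q(τ+1)`, the pairing `(τ-1)·G(τ) - ∫_{τ-1}^{τ} G` is constant, `= 0`
(`ofReal_mul_modelEval_neg_one_eq_integral`; proved directly by the fundamental theorem of calculus for
`t ↦ (t-1)·G(t)` on `[2, τ]`). A maximum argument on `[1, M+1]` then gives `‖G‖ ≤ 1` there
(`norm_modelEval_neg_one_le_one`) and `‖G(τ)‖ ≤ 1/(τ-1)` (`norm_modelEval_neg_one_le`), i.e. the limit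
form of Alladi's parity balance of the rough integers: `|Σ_{j≤M} (-1)^j I_j(M)| ≤ 1/(M-1)`
(`abs_alternating_sum_le`), to be compared with `Σ_j I_j(M) ≥ I_1 = 1`.

References: K. Alladi, *Asymptotic estimates of sums involving the Moebius function. II*, Trans. AMS 272
(1982) 87–105; Quart. J. Math. Oxford (2) 33 (1982) 129–148 [Alladi1982]; G. Tenenbaum, *Introduction to
analytic and probabilistic number theory*, III.6 [Tenenbaum2015] (adjoint differential-difference
equations, after de Bruijn and Iwaniec). Only standard calculus is used; no named facts.
-/

noncomputable section

namespace Summit.Parity.GeneralizedHardyLittlewood.Theorems.ModelCellFacts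

open scoped BigOperators Topology
open Filter Set MeasureTheory
open Summit.Parity.GeneralizedHardyLittlewood.Cruxes.ModelHyperbolicity.WindowChainTransport

/-! ## The parity point `z = -1` of the model family -/

/-- Reindexing `Icc 1 M` by `range M`. -/
theorem sum_Icc_one_eq_sum_range {α : Type*} [AddCommMonoid α] (f : ℕ → α) (M : ℕ) :
    ∑ j ∈ Finset.Icc 1 M, f j = ∑ i ∈ Finset.range M, f (i + 1) := by
  induction M with
  | zero => simp
  | succ M ih => rw [Finset.sum_Icc_succ_top (by omega), ih, Finset.sum_range_succ]

/-- At `z = -1` the model family is minus the alternating density sum: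
`G_M(τ;-1) = -Σ_{1 ≤ j ≤ M} (-1)^j I_j(τ)`. -/
theorem modelEval_neg_one (M : ℕ) (τ : ℝ) :
    modelEval M τ (-1) =
      ((-∑ j ∈ Finset.Icc 1 M, (-1 : ℝ) ^ j * cellDensity (j - 1) τ : ℝ) : ℂ) := by
  unfold modelEval
  rw [sum_Icc_one_eq_sum_range, ← Finset.sum_neg_distrib]
  push_cast
  refine Finset.sum_congr rfl fun i _ => ?_
  ring

/-- On `[1,2]` the parity point is `1`: `G_M(τ;-1) = 1` for `τ ≤ 2`, `M ≥ 1`. -/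
theorem modelEval_neg_one_of_le_two {M : ℕ} (hM : 1 ≤ M) {τ : ℝ} (hτ : τ ≤ 2) :
    modelEval M τ (-1) = 1 :=
  modelEval_of_le_two hM hτ (-1)

/-- **The adjoint identity.** For `M ≥ 2` and `2 ≤ τ ≤ M+1`:
`(τ - 1)·G_M(τ;-1) = ∫_{τ-1}^{τ} G_M(t;-1) dt` — the pairing of `G` with the solution `q(τ) = τ-1`
of the adjoint equation is constant. Proof: FTC for `t ↦ (t-1) G(t)` on `[2, τ]`, whose derivative
is `G(t) - G(t-1)` by the delay equation, and `G ≡ 1` on `[1,2]`. -/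
theorem ofReal_mul_modelEval_neg_one_eq_integral {M : ℕ} (hM : 2 ≤ M) {τ : ℝ} (h2 : 2 ≤ τ)
    (hτ : τ ≤ (M : ℝ) + 1) :
    ((τ - 1 : ℝ) : ℂ) * modelEval M τ (-1) = ∫ t in (τ - 1)..τ, modelEval M t (-1) := by
  set G : ℝ → ℂ := fun t => modelEval M t (-1) with hG
  have hGc : Continuous G := calc_continuous_modelEval M (-1)
  have hGi : ∀ a b : ℝ, IntervalIntegrable G volume a b := fun a b => hGc.intervalIntegrable a b
  have hM1 : 1 ≤ M := le_trans (by norm_num) hM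
  -- FTC for `f t = (t-1) G t` on `[2, τ]`
  have hderiv : ∀ t ∈ Ioo 2 τ,
      HasDerivAt (fun t : ℝ => ((t - 1 : ℝ) : ℂ) * G t) (G t - G (t - 1)) t := by
    intro t ht
    have hG' : HasDerivAt G (-1 * G (t - 1) / ((t : ℂ) - 1)) t :=
      calc_hasDerivAt_modelEval hM (-1) ht.1 (ht.2.le.trans hτ)
    have hlin : HasDerivAt (fun t : ℝ => ((t - 1 : ℝ) : ℂ)) ((1 : ℝ) : ℂ) t :=
      ((hasDerivAt_id t).sub_const 1).ofReal_comp
    refine (hlin.mul hG').congr_deriv ?_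
    have ht1 : ((t - 1 : ℝ) : ℂ) ≠ 0 := Complex.ofReal_ne_zero.mpr (by linarith [ht.1])
    have ht1' : (t : ℂ) - 1 = ((t - 1 : ℝ) : ℂ) := by push_cast; ring
    rw [ht1']
    field_simp
    push_cast
    ring
  have hcont : ContinuousOn (fun t : ℝ => ((t - 1 : ℝ) : ℂ) * G t) (Icc 2 τ) :=
    ((Complex.continuous_ofReal.comp (continuous_id.sub continuous_const)).mul hGc).continuousOn
  have hint : IntervalIntegrable (fun t => G t - G (t - 1)) volume 2 τ :=
    (hGc.sub (hGc.comp (continuous_id.sub continuous_const))).intervalIntegrable _ _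
  have e1 := intervalIntegral.integral_eq_sub_of_hasDerivAt_of_le h2 hcont hderiv hint
  have e2 : ∫ t in (2 : ℝ)..τ, (G t - G (t - 1)) =
      (∫ t in (2 : ℝ)..τ, G t) - ∫ t in (2 : ℝ)..τ, G (t - 1) :=
    intervalIntegral.integral_sub (hGi 2 τ) ((hGc.comp (continuous_id.sub continuous_const)).intervalIntegrable _ _)
  have e3 : ∫ t in (2 : ℝ)..τ, G (t - 1) = ∫ t in (1 : ℝ)..(τ - 1), G t := by
    rw [intervalIntegral.integral_comp_sub_right G 1]; norm_num
  have e4 : (∫ t in (1 : ℝ)..2, G t) + ∫ t in (2 : ℝ)..τ, G t = ∫ t in (1 : ℝ)..τ, G t :=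
    intervalIntegral.integral_add_adjacent_intervals (hGi 1 2) (hGi 2 τ)
  have e5 : ∫ t in (1 : ℝ)..2, G t = 1 := by
    have h : EqOn G (fun _ => (1 : ℂ)) (uIcc (1 : ℝ) 2) := by
      intro t ht
      rw [uIcc_of_le (by norm_num)] at ht
      exact modelEval_neg_one_of_le_two hM1 ht.2
    rw [intervalIntegral.integral_congr h, intervalIntegral.integral_const]
    norm_num
  have e6 : (∫ t in (1 : ℝ)..(τ - 1), G t) + ∫ t in (τ - 1)..τ, G t = ∫ t in (1 : ℝ)..τ, G t :=
    intervalIntegral.integral_add_adjacent_intervals (hGi 1 (τ - 1)) (hGi (τ - 1) τ)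
  have e7 : ((2 - 1 : ℝ) : ℂ) * G 2 = 1 := by
    rw [show G 2 = 1 from modelEval_neg_one_of_le_two hM1 le_rfl]; push_cast; ring
  linear_combination -e1 + e2 - e3 + e4 - e5 - e6 + e7

/-- **Sup bound** `‖G_M(τ;-1)‖ ≤ 1` on `[1, M+1]` (`M ≥ 2`): at a maximum point `τ* > 2` of `‖G‖`
the adjoint identity gives `(τ*-1)·‖G(τ*)‖ ≤ sup ‖G‖ = ‖G(τ*)‖`, forcing `‖G(τ*)‖ = 0`; at `τ* ≤ 2`,
`G(τ*) = 1`. -/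
theorem norm_modelEval_neg_one_le_one {M : ℕ} (hM : 2 ≤ M) {τ : ℝ} (h1 : 1 ≤ τ)
    (hτ : τ ≤ (M : ℝ) + 1) : ‖modelEval M τ (-1)‖ ≤ 1 := by
  set G : ℝ → ℂ := fun t => modelEval M t (-1) with hG
  have hGc : Continuous G := calc_continuous_modelEval M (-1)
  have hM1 : 1 ≤ M := le_trans (by norm_num) hM
  have hK : IsCompact (Icc (1 : ℝ) ((M : ℝ) + 1)) := isCompact_Icc
  have hne : (Icc (1 : ℝ) ((M : ℝ) + 1)).Nonempty := ⟨1, le_rfl, by linarith⟩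
  obtain ⟨s, hs, hmax⟩ := hK.exists_isMaxOn hne (hGc.norm.continuousOn)
  have hsup : ∀ t ∈ Icc (1 : ℝ) ((M : ℝ) + 1), ‖G t‖ ≤ ‖G s‖ := fun t ht => hmax ht
  have hS : ‖G s‖ ≤ 1 := by
    rcases le_or_gt s 2 with hs2 | hs2
    · rw [show G s = 1 from modelEval_neg_one_of_le_two hM1 hs2]; simp
    · have hid := ofReal_mul_modelEval_neg_one_eq_integral hM hs2.le hs.2
      have hbound : ‖∫ t in (s - 1)..s, G t‖ ≤ ‖G s‖ * |s - (s - 1)| := by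
        refine intervalIntegral.norm_integral_le_of_norm_le_const fun t ht => hsup t ?_
        rw [uIoc_of_le (by linarith)] at ht
        exact ⟨by linarith [ht.1, hs.1], ht.2.trans hs.2⟩
      have hnorm : ‖((s - 1 : ℝ) : ℂ) * G s‖ = (s - 1) * ‖G s‖ := by
        rw [norm_mul, Complex.norm_real, Real.norm_of_nonneg (by linarith)]
      rw [← hid, hnorm, show s - (s - 1) = (1 : ℝ) by ring, abs_one, mul_one] at hbound
      nlinarith [norm_nonneg (G s)]
  exact (hsup τ ⟨h1, hτ⟩).trans hS

/-- **Decay at the parity point**: `‖G_M(τ;-1)‖ ≤ 1/(τ-1)` for `2 ≤ τ ≤ M+1`, `M ≥ 2`. -/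
theorem norm_modelEval_neg_one_le {M : ℕ} (hM : 2 ≤ M) {τ : ℝ} (h2 : 2 ≤ τ)
    (hτ : τ ≤ (M : ℝ) + 1) : ‖modelEval M τ (-1)‖ ≤ 1 / (τ - 1) := by
  have hid := ofReal_mul_modelEval_neg_one_eq_integral hM h2 hτ
  have hbound : ‖∫ t in (τ - 1)..τ, modelEval M t (-1)‖ ≤ 1 * |τ - (τ - 1)| := by
    refine intervalIntegral.norm_integral_le_of_norm_le_const fun t ht => ?_
    rw [uIoc_of_le (by linarith)] at ht
    exact norm_modelEval_neg_one_le_one hM (by linarith [ht.1]) (ht.2.trans hτ)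
  have hnorm : ‖((τ - 1 : ℝ) : ℂ) * modelEval M τ (-1)‖ = (τ - 1) * ‖modelEval M τ (-1)‖ := by
    rw [norm_mul, Complex.norm_real, Real.norm_of_nonneg (by linarith)]
  rw [← hid, hnorm, show τ - (τ - 1) = (1 : ℝ) by ring, abs_one, mul_one] at hbound
  rw [le_div_iff₀ (by linarith)]
  linarith

/-- **Parity balance of the densities**: `|Σ_{1 ≤ j ≤ M} (-1)^j I_j(M)| ≤ 1/(M-1)` for `M ≥ 2`. -/
theorem abs_alternating_sum_le {M : ℕ} (hM : 2 ≤ M) :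
    |∑ j ∈ Finset.Icc 1 M, (-1 : ℝ) ^ j * cellDensity (j - 1) M| ≤ 1 / ((M : ℝ) - 1) := by
  have h := norm_modelEval_neg_one_le hM (τ := (M : ℝ)) (by exact_mod_cast hM) (by linarith)
  rwa [modelEval_neg_one, Complex.norm_real, Real.norm_eq_abs, abs_neg] at h

end Summit.Parity.GeneralizedHardyLittlewood.Theorems.ModelCellFacts

end
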